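import Summits.Langlands.Langlands.Theses.EvenArtinQuantumBoundary
import Literature.NumberTheory.GaloisRepresentations.ArtinLFunctionRatLSeriesProofs
import HarnessLib

/-!
# `EvenArtinQuantumBoundary.ArtinDirichletCoefficients` (stmt-Langlands-3314) — by citation

The support item stmt-Langlands-3314 of route `EvenArtinQuantumBoundary` asks, for every
`σ : Γ_ℚ → GL₂(ℂ)` (a framed Artin representation), for Dirichlet coefficients `a : ℕ → ℂ` with
`|a(n)| ≤ d(n)` and `∑ a(n) n^{-s} = L(s, σ)` on `re s > 1`.  The accepted Literature theorem
`Literature.NumberTheory.GaloisRepresentations.FramedArtinRep.exists_LSeries_eq_artinLFunction_two`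
(ArtinLFunctionRatLSeriesProofs.lean:469, [cite: DeligneSerreASENS1974, §9 Thm. 9.1 and Cor. 9.2])
gives a normalised multiplicative such `a` with exactly these two properties among its conjuncts; this
file closes the item BY NAME (reuse the existing declaration — the route's `closes` already consumes the
same theorem).  Nothing here proves `Langlands`; the item is a support leaf (rank 9), out of the cone of
the route's deciding theorem.
-/

set_option linter.dupNamespace false -- project-wide option; `Summit.Langlands.Langlands` is the mandated namespace

namespace Summit.Langlands.Langlands.Theorems.EvenArtinQuantumBoundaryArtinDirichletCoefficients

open Summit.Langlands.Langlands.Theses.EvenArtinQuantumBoundary in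
/-- **stmt-Langlands-3314** `ArtinDirichletCoefficients`: divisor-bounded Dirichlet coefficients of a
`2`-dimensional Artin `L`-function over `ℚ`, by the Literature witness
`FramedArtinRep.exists_LSeries_eq_artinLFunction_two`. [cite: DeligneSerreASENS1974, §9 Thm. 9.1 and Cor. 9.2] -/
theorem artinDirichletCoefficients : ArtinDirichletCoefficients := by
  intro σ
  obtain ⟨a, -, -, -, hbound, hL⟩ :=
    Literature.NumberTheory.GaloisRepresentations.FramedArtinRep.exists_LSeries_eq_artinLFunction_two σ
  exact ⟨a, hbound, fun s hs => (hL s hs).2⟩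

end Summit.Langlands.Langlands.Theorems.EvenArtinQuantumBoundaryArtinDirichletCoefficients
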